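import Summits.KontsevichZagierPeriods.KontsevichZagierPeriods.Theorems.UnfoldedStokesStokesGenerationStubLandenPartOne
import Summits.KontsevichZagierPeriods.KontsevichZagierPeriods.Theorems.UnfoldedStokesStokesGenerationStubLandenPartTwo
import Summits.KontsevichZagierPeriods.KontsevichZagierPeriods.Theorems.UnfoldedStokesStokesGenerationStubLandenPartThree
import Summits.KontsevichZagierPeriods.KontsevichZagierPeriods.Theorems.UnfoldedStokesStokesGenerationStubLandenLeftovers
import Summits.KontsevichZagierPeriods.KontsevichZagierPeriods.Theorems.UnfoldedStokesStokesGenerationFibrewiseClosureSum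
import Summits.KontsevichZagierPeriods.KontsevichZagierPeriods.Theorems.UnfoldedStokesStokesGenerationFibrewiseRungAngSwap

/-!
# `StokesGeneration` (stmt-KontsevichZagierPeriods-3586), line `fibrewise_stokes` — rung 18: Landen's identity is
# fibrewise-Stokes decomposable

Crux `Summit.KontsevichZagierPeriods.KontsevichZagierPeriods.Theses.UnfoldedStokes.StokesGeneration`; residual stub S2
`stub_fibrewiseStokesGeneration` (`FibStokesDecomposable`, `Theorems/UnfoldedStokesDefs.lean`). The dilogarithm at a real
algebraic argument `w < 1` is the period `Li₂(w) = ∫_{[0,1]²} w/(1 − wst) ds dt` of a bounded cube integrand, and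
`log(1 − a) = ∫₀¹ −a/(1 − as) ds`. LANDEN'S IDENTITY `Li₂(a) + Li₂(−a/(1−a)) = −½log²(1−a)` (`a < 1`) therefore says that the
cube integrand `a/(1−ast) − a/(1−a+ast) + ½a²/((1−as)(1−at))` on `[0,1]²` has value `0`, and this file proves that it is
fibrewise-Stokes decomposable (`fibStokesDecomposable_landen`) — the first weight-2 identity of the line that is NOT a pointwise
move of the cube (it mixes the arguments `a` and `−a/(1−a)`; the polylogarithm duplication relators of
`stub_polylogDuplication` were pointwise instances of rule (2) for the squaring map).

Certificate — transcendence-free and value-free (the vanishing of the value is a consequence). Homotopy `a ↦ au` in a third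
cube coordinate `u`: `F(s,t,u) = T₁ + T₂ + T₃` with `T₁ = au/(1−aust)` (`Li₂(au)`), `T₂ = −au/(1−au+aust)`
(`Li₂(−au/(1−au))`), `T₃ = ½a²u²/((1−aus)(1−aut))` (`½log²(1−au)`), `F|_{u=0} = 0`, `F|_{u=1}` = Landen. For each `Tᵢ` one
element ALONG `u` (primitive `Tᵢ`) trades `Tᵢ|_{u=1}` for `∂_uTᵢ`, and one element along `t` or `s` with a closed-form RATIONAL
primitive integrates `∂_uTᵢ` out (`stub_landenPartOne/Two/Three`, two elements each): what is left is
`R₁(s,u) + R₂(s,u) + A(s,t,u) + R₃(t,u)` with `A` antisymmetric under `s ↔ t`, `R₃(t,u) − R₃(s,u)` antisymmetric, and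
`R₁ + R₂ + R₃ = (a/(1−au))·(g(s) − g(1−s))` for `g(s) = 1/(1−aus)` — all decomposable by the SOFT relators of rung 12
(`stub_landenLeftovers`: one reflection, two transpositions). Summing up (closure under sums, agreement on the cube, un-padding)
gives the theorem.

References: D. Zagier, *The dilogarithm function* (2007), §I.2 (functional equations; Landen); M. Kontsevich, D. Zagier,
*Periods* (2001), §1.1–1.2.
-/

noncomputable section

-- `Summit.KontsevichZagierPeriods.KontsevichZagierPeriods.…` is the tree's mandated layout (single-conjunct summit).
set_option linter.dupNamespace false

namespace Summit.KontsevichZagierPeriods.KontsevichZagierPeriods.Cruxes.StokesGeneration.FibrewiseStokes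

open MeasureTheory Set
open Literature.NumberTheory.Transcendental
open Literature.NumberTheory.Transcendental.KZ
open Literature.ModelTheory.ExponentialFields (IsSemialgebraic)


/-- Positivity of the Landen denominators: `0 < 1 − a·p` for `a < 1` and `p ∈ [0,1]`. [folklore] -/
theorem landen_denom_pos {a p : ℝ} (ha1 : a < 1) (hp0 : 0 ≤ p) (hp1 : p ≤ 1) : 0 < 1 - a * p := by
  rcases le_or_gt 0 a with ha0 | ha0
  · nlinarith
  · nlinarith

/-- **Rung 18 (lead c6): Landen's identity is fibrewise-Stokes decomposable.** For real algebraic `a < 1` the cube integrand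
`a/(1−ast) − a/(1−a+ast) + ½a²/((1−as)(1−at))` on `[0,1]²` — whose value is `Li₂(a) + Li₂(−a/(1−a)) + ½log²(1−a) = 0`
(Landen) — is decomposable: the homotopy `a ↦ au` in a third coordinate (`stub_landenPartOne/Two/Three`: one element along
`u` and one closed-form rational element along `t` or `s` per term) leaves `R₁ + R₂ + A + R₃`, which is decomposable by the
soft relators of rung 12 (`stub_landenLeftovers`: a reflection and two transpositions). Weight 2, non-separated, NOT a
pointwise cube move (the arguments `a` and `−a/(1−a)` are mixed); transcendence-free and value-free — the vanishing of the
value is a CONSEQUENCE. [cite: Zagier2007Dilogarithm, §I.2] -/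
theorem fibStokesDecomposable_landen (a : ℝ) (ha : IsAlgebraic ℚ a) (ha1 : a < 1) :
    FibStokesDecomposable 2 (fun x => a / (1 - a * x 0 * x 1) - a / (1 - a + a * x 0 * x 1) +
      (1 / 2) * ((-a / (1 - a * x 0)) * (-a / (1 - a * x 1)))) := by
  have h1 := stub_landenPartOne a ha ha1
  have h2 := stub_landenPartTwo a ha ha1
  have h3 := stub_landenPartThree a ha ha1
  have h4 := stub_landenLeftovers a ha ha1
  have h123 := fibStokesDecomposable_add 3 _ _ (fibStokesDecomposable_add 3 _ _ h1 h2) h3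
  have hdiff := fibStokesDecomposable_sub 3 _ _ h4 h123
  have hle : 2 ≤ 3 := by norm_num
  refine fibStokesDecomposable_unpad hle _ (fibStokesDecomposable_congr_off_null 3 _ _ ∅
    Literature.ModelTheory.ExponentialFields.isSemialgebraic_empty measure_empty (fun x hx _ => ?_) hdiff)
  have hm : ∀ i, x i ∈ Set.Icc (0:ℝ) 1 := fun i => (Set.mem_univ_pi.mp hx) i
  have e0 : x (Fin.castLE hle 0) = x 0 := rfl
  have e1 : x (Fin.castLE hle 1) = x 1 := rfl
  simp only [e0, e1]
  have h0 := hm 0; have h1' := hm 1; have h2' := hm 2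
  simp only [Set.mem_Icc] at h0 h1' h2'
  have hmul : ∀ {p q : ℝ}, 0 ≤ p → p ≤ 1 → 0 ≤ q → q ≤ 1 → 0 ≤ p * q ∧ p * q ≤ 1 :=
    fun hp0 hp1 hq0 hq1 => ⟨mul_nonneg hp0 hq0, by nlinarith⟩
  have d20 : 0 < 1 - a * x 2 * x 0 := by
    have := hmul h2'.1 h2'.2 h0.1 h0.2; rw [mul_assoc]; exact landen_denom_pos ha1 this.1 this.2
  have d21 : 0 < 1 - a * x 2 * x 1 := by
    have := hmul h2'.1 h2'.2 h1'.1 h1'.2; rw [mul_assoc]; exact landen_denom_pos ha1 this.1 this.2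
  have d01 : 0 < 1 - a * x 0 * x 1 := by
    have := hmul h0.1 h0.2 h1'.1 h1'.2; rw [mul_assoc]; exact landen_denom_pos ha1 this.1 this.2
  have d2 : 0 < 1 - a * x 2 := landen_denom_pos ha1 h2'.1 h2'.2
  have d0 : 0 < 1 - a * x 0 := landen_denom_pos ha1 h0.1 h0.2
  have d1 : 0 < 1 - a * x 1 := landen_denom_pos ha1 h1'.1 h1'.2
  have d2r : 0 < 1 - a * x 2 + a * x 2 * x 0 := by
    have hq : 0 ≤ x 2 * (1 - x 0) ∧ x 2 * (1 - x 0) ≤ 1 := hmul h2'.1 h2'.2 (by linarith) (by linarith)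
    have := landen_denom_pos ha1 hq.1 hq.2; nlinarith
  have dr : 0 < 1 - a + a * x 0 * x 1 := by
    have hq : 0 ≤ 1 - x 0 * x 1 ∧ 1 - x 0 * x 1 ≤ 1 := by
      have := hmul h0.1 h0.2 h1'.1 h1'.2; exact ⟨by linarith, by linarith⟩
    have := landen_denom_pos ha1 hq.1 hq.2; nlinarith
  field_simp
  ring


end Summit.KontsevichZagierPeriods.KontsevichZagierPeriods.Cruxes.StokesGeneration.FibrewiseStokes

end
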